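import Literature.NumberTheory.Transcendental.LineJetForms
import HarnessLib

/-!
# Generic-coefficient models of the line derivations and chart polynomials; base change

Topic: `Literature/NumberTheory/Transcendental`. Plan item W4/S2b (first half) of the unit
`provefact-Literature.NumberTheory.Transcendental.H-b596640137`. The line derivation data
`genODE` (`LineODEGens.lean`) and the chart polynomials `HPoly` (`LineODETheta.lean`) were
defined over `ℂ` with the specific coefficients `g₂, g₃, κ_{eb}` and the coordinates of the
direction `x`. For the arithmetic of Baker's method (conjugates, denominators: `ArithPoly.lean`)
one needs the SAME polynomials with coefficients in a number field `K ⊂ ℂ` containing these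
numbers. This file therefore introduces the generic-coefficient models over any commutative ring
`R` — `genODEᵣ g₂ g₃ κ x`, `rPolyᵣ`, `corrPolyᵣ g₂ g₃`, `TPolyᵣ`, `HPolyᵣ g₂ g₃ κ`,
`homogᵣ` — and PROVES:

* they specialise to the landed `ℂ`-definitions (`genODEᵣ_complex`, `HPolyᵣ_complex`, …);
* they commute with `MvPolynomial.map f` for ring maps `f : R →+* S` (`map_genODEᵣ`, …);
* **base change of derivations and words** (`PolyODE.map_mkDerivation`, `PolyODE.map_wordApp`):
  `map f (D_Q F) = D_{map f ∘ Q} (map f F)`, hence the word forms of `LineJetForms.lean` computed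
  over `K` map to those over `ℂ` (`wordForm_eq_algebraMap`).

## References

* A. Baker, G. Wüstholz, *Logarithmic Forms and Diophantine Geometry*, CUP 2007, §6.8.
-/

noncomputable section

open MvPolynomial
open scoped PeriodPair

namespace Literature.NumberTheory.Transcendental

/-! ### Base change of polynomial derivations and words -/

namespace PolyODE

variable {R S ι : Type*} [CommRing R] [CommRing S]

/-- **Base change of a polynomial derivation**: `map f (D_Q F) = D_{map f ∘ Q}(map f F)`.
[folklore] -/
theorem map_mkDerivation (f : R →+* S) (Q : ι → MvPolynomial ι R) (F : MvPolynomial ι R) :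
    map f (mkDerivation R Q F) = mkDerivation S (fun i => map f (Q i)) (map f F) := by
  induction F using MvPolynomial.induction_on with
  | C a =>
    rw [map_C, ← algebraMap_eq, ← algebraMap_eq, Derivation.map_algebraMap, Derivation.map_algebraMap,
      map_zero]
  | add p q hp hq => rw [map_add, map_add, map_add, map_add, hp, hq]
  | mul_X p i hp =>
    rw [Derivation.leibniz, map_mul, map_X, Derivation.leibniz, mkDerivation_X, mkDerivation_X]
    simp only [smul_eq_mul, map_add, map_mul, map_X, hp]

variable {M : Type*} [AddCommMonoid M] [Module R M]

omit [CommRing S] in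
/-- Unfolding the word recursion at a non-empty word. [folklore] -/
theorem wordApp_succ {ι' : Type*} (D : ι' → M →ₗ[R] M) {k : ℕ} (ω : Fin (k + 1) → ι') (H : M) :
    wordApp D ω H = D (ω 0) (wordApp D (Fin.tail ω) H) := rfl

/-- **Base change of words**: `map f (W_ω^{(Q)} F) = W_ω^{(map f ∘ Q)} (map f F)`. [folklore] -/
theorem map_wordApp {d : ℕ} (f : R →+* S) (Q : Fin d → ι → MvPolynomial ι R) :
    ∀ {k : ℕ} (ω : Fin k → Fin d) (F : MvPolynomial ι R),
      map f (wordApp (fun m => (mkDerivation R (Q m)).toLinearMap) ω F) =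
        wordApp (fun m => (mkDerivation S (fun i => map f (Q m i))).toLinearMap) ω (map f F)
  | 0, ω, F => by simp
  | k + 1, ω, F => by
    rw [wordApp_succ, wordApp_succ]
    change map f (mkDerivation R (Q (ω 0)) (wordApp _ (Fin.tail ω) F)) =
      mkDerivation S _ (wordApp _ (Fin.tail ω) (map f F))
    rw [map_mkDerivation, map_wordApp f Q (Fin.tail ω) F]

end PolyODE

/-! ### Generic-coefficient models of `genODE` and `HPoly` -/

namespace GaGmE

namespace Std

variable {β γ δ : Type} [Fintype β] [Fintype γ] [Fintype δ] [DecidableEq γ]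

section Model

variable {R S : Type*} [Field R] [Field S]

/-- Generic-coefficient model of `factorODE`. [folklore] -/
def factorODEᵣ (g2 g3 : R) (lat : Bool) (b : γ) (i : Fin 2) : MvPolynomial (Gen β γ δ) R :=
  let X0 : MvPolynomial (Gen β γ δ) R := X (Sum.inr (Sum.inl (b, 0)))
  let X1 : MvPolynomial (Gen β γ δ) R := X (Sum.inr (Sum.inl (b, 1)))
  if lat then
    ![-6 * X1 ^ 2 + C (g2 / 2) * X0 ^ 2,
      C (-1 / 2) - C g2 * X1 * X0 - C (3 * g3 / 2) * X0 ^ 2] i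
  else
    ![X1, 6 * X0 ^ 2 - C (g2 / 2)] i

/-- Generic-coefficient model of `zetaHatODE`. [folklore] -/
def zetaHatODEᵣ (g2 g3 : R) (lat : Bool) (b : γ) : MvPolynomial (Gen β γ δ) R :=
  let X0 : MvPolynomial (Gen β γ δ) R := X (Sum.inr (Sum.inl (b, 0)))
  let X1 : MvPolynomial (Gen β γ δ) R := X (Sum.inr (Sum.inl (b, 1)))
  if lat then -(C (2 * g2)) * X1 ^ 2 - C (3 * g3) * X1 * X0 else -X0

/-- **Generic-coefficient model of the line derivation data `genODE`** (coefficients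
`g₂, g₃ ∈ R`, `κ : δ → γ → R`, direction coordinates `x : _ → R`). [folklore] -/
def genODEᵣ (g2 g3 : R) (κ : δ → γ → R) (c : γ → Bool) (x : β ⊕ (γ ⊕ δ) → R) :
    Gen β γ δ → MvPolynomial (Gen β γ δ) R
  | Sum.inl j => C (x (iy j)) * X (Sum.inl j)
  | Sum.inr (Sum.inl (b, i)) => C (x (iz b)) * factorODEᵣ g2 g3 (c b) b i
  | Sum.inr (Sum.inr e) => C (x (is e)) - ∑ b, C (κ e b * x (iz b)) * zetaHatODEᵣ g2 g3 (c b) b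

/-- Generic-coefficient model of `rPoly` (coefficient-free). [folklore] -/
def rPolyᵣ (lat : Bool) (b : γ) (i : Fin 3) : MvPolynomial (Gen β γ δ) R :=
  let X0 : MvPolynomial (Gen β γ δ) R := X (Sum.inr (Sum.inl (b, 0)))
  let X1 : MvPolynomial (Gen β γ δ) R := X (Sum.inr (Sum.inl (b, 1)))
  if lat then ![X0, X1, 1] i else ![1, X0, X1] i

/-- Generic-coefficient model of `corrPoly`. [folklore] -/
def corrPolyᵣ (g2 g3 : R) (lat : Bool) (b : γ) (i : Fin 3) : MvPolynomial (Gen β γ δ) R :=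
  let X0 : MvPolynomial (Gen β γ δ) R := X (Sum.inr (Sum.inl (b, 0)))
  let X1 : MvPolynomial (Gen β γ δ) R := X (Sum.inr (Sum.inl (b, 1)))
  if lat then
    ![-2 * X1 ^ 2, -(C (1 / 2)) - C (g2 / 2) * X1 * X0 - C (g3 / 2) * X0 ^ 2, 0] i
  else ![0, 0, 2 * X0 ^ 2] i

/-- Generic-coefficient model of `TPoly` (coefficient-free). [folklore] -/
def TPolyᵣ : Option β → MvPolynomial (Gen β γ δ) R
  | none => 1
  | some j => X (Sum.inl j)

/-- **Generic-coefficient model of the chart polynomials `HPoly`.** [folklore] -/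
def HPolyᵣ (g2 g3 : R) (κ : δ → γ → R) (c : γ → Bool) :
    Option β × ThetaIdx γ δ → MvPolynomial (Gen β γ δ) R
  | (a, (M, none)) => TPolyᵣ a * ∏ b, rPolyᵣ (c b) b (M b)
  | (a, (M, some e)) => TPolyᵣ a *
      (X (Sum.inr (Sum.inr e)) * ∏ b, rPolyᵣ (c b) b (M b) -
        ∑ b, C (κ e b) * (corrPolyᵣ g2 g3 (c b) b (M b) * ∏ b' ∈ Finset.univ.erase b, rPolyᵣ (c b') b' (M b')))

/-! #### Specialisation to the landed `ℂ`-definitions -/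

omit [Fintype β] [Fintype δ] [DecidableEq γ] in
/-- `genODEᵣ` over `ℂ` with the coefficients of `L, κ` is `genODE`. [folklore] -/
theorem genODEᵣ_complex (L : PeriodPair) (κM : δ → γ → Kbar) (c : γ → Bool)
    (x : β ⊕ (γ ⊕ δ) → ℂ) :
    genODEᵣ L.g₂ L.g₃ (fun e b => (κM e b : ℂ)) c x = genODE L κM c x := by
  funext i
  rcases i with j | ⟨b, i⟩ | e <;> rfl

omit [Fintype β] [Fintype δ] in
/-- `HPolyᵣ` over `ℂ` with the coefficients of `L, κ` is `HPoly`. [folklore] -/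
theorem HPolyᵣ_complex (L : PeriodPair) (κM : δ → γ → Kbar) (c : γ → Bool) :
    (HPolyᵣ L.g₂ L.g₃ (fun e b => (κM e b : ℂ)) c :
      Option β × ThetaIdx γ δ → MvPolynomial (Gen β γ δ) ℂ) = HPoly L κM c := by
  funext J
  rcases J with ⟨a, M, _ | e⟩ <;> rfl

/-! #### Compatibility with `MvPolynomial.map` -/

omit [Fintype β] [Fintype γ] [Fintype δ] [DecidableEq γ] in
/-- `factorODEᵣ` commutes with base change. [folklore] -/
theorem map_factorODEᵣ (f : R →+* S) (g2 g3 : R) (lat : Bool) (b : γ) (i : Fin 2) :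
    map f (factorODEᵣ (β := β) (δ := δ) g2 g3 lat b i) = factorODEᵣ (f g2) (f g3) lat b i := by
  cases lat <;> fin_cases i <;> simp [factorODEᵣ, map_div₀, map_ofNat]

omit [Fintype β] [Fintype γ] [Fintype δ] [DecidableEq γ] in
/-- `zetaHatODEᵣ` commutes with base change. [folklore] -/
theorem map_zetaHatODEᵣ (f : R →+* S) (g2 g3 : R) (lat : Bool) (b : γ) :
    map f (zetaHatODEᵣ (β := β) (δ := δ) g2 g3 lat b) = zetaHatODEᵣ (f g2) (f g3) lat b := by
  cases lat <;> simp [zetaHatODEᵣ, map_ofNat]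

omit [Fintype β] [Fintype δ] [DecidableEq γ] in
/-- **`genODEᵣ` commutes with base change.** [folklore] -/
theorem map_genODEᵣ (f : R →+* S) (g2 g3 : R) (κ : δ → γ → R) (c : γ → Bool)
    (x : β ⊕ (γ ⊕ δ) → R) (i : Gen β γ δ) :
    map f (genODEᵣ g2 g3 κ c x i) =
      genODEᵣ (f g2) (f g3) (fun e b => f (κ e b)) c (fun k => f (x k)) i := by
  rcases i with j | ⟨b, i⟩ | e
  · simp [genODEᵣ]
  · simp [genODEᵣ, map_factorODEᵣ]
  · simp [genODEᵣ, map_zetaHatODEᵣ, map_sum]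

omit [Fintype β] [Fintype γ] [Fintype δ] [DecidableEq γ] in
/-- `rPolyᵣ` commutes with base change. [folklore] -/
theorem map_rPolyᵣ (f : R →+* S) (lat : Bool) (b : γ) (i : Fin 3) :
    map f (rPolyᵣ (β := β) (δ := δ) (R := R) lat b i) = rPolyᵣ lat b i := by
  cases lat <;> fin_cases i <;> simp [rPolyᵣ]

omit [Fintype β] [Fintype γ] [Fintype δ] [DecidableEq γ] in
/-- `corrPolyᵣ` commutes with base change. [folklore] -/
theorem map_corrPolyᵣ (f : R →+* S) (g2 g3 : R) (lat : Bool) (b : γ) (i : Fin 3) :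
    map f (corrPolyᵣ (β := β) (δ := δ) g2 g3 lat b i) = corrPolyᵣ (f g2) (f g3) lat b i := by
  cases lat <;> fin_cases i <;> simp [corrPolyᵣ, map_div₀, map_ofNat]

omit [Fintype β] [Fintype γ] [Fintype δ] [DecidableEq γ] in
/-- `TPolyᵣ` commutes with base change. [folklore] -/
theorem map_TPolyᵣ (f : R →+* S) (a : Option β) :
    map f (TPolyᵣ (γ := γ) (δ := δ) (R := R) a) = TPolyᵣ a := by
  cases a <;> simp [TPolyᵣ]

omit [Fintype β] [Fintype δ] in
/-- **`HPolyᵣ` commutes with base change.** [folklore] -/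
theorem map_HPolyᵣ (f : R →+* S) (g2 g3 : R) (κ : δ → γ → R) (c : γ → Bool)
    (J : Option β × ThetaIdx γ δ) :
    map f (HPolyᵣ g2 g3 κ c J) = HPolyᵣ (f g2) (f g3) (fun e b => f (κ e b)) c J := by
  rcases J with ⟨a, M, _ | e⟩
  · simp [HPolyᵣ, map_TPolyᵣ, map_rPolyᵣ, map_prod]
  · simp [HPolyᵣ, map_TPolyᵣ, map_rPolyᵣ, map_corrPolyᵣ, map_prod, map_sum]

end Model

/-! ### The word forms computed over a subfield -/

omit [Fintype β] [Fintype δ] in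
/-- **Word forms over a field of definition.** Let `f : K →+* ℂ` be a field embedding sending
`g₂ᴷ, g₃ᴷ, κᴷ, xᴷ` to `g₂, g₃, κ, x`, `gᴷ` to the generator values at `w`, and `Pᴷ` to `P`. Then the
word form `Λ_ω(P)` at `w` is the image under `f` of the same expression computed over `K`:
`Λ_ω(P) = f( (W^K_ω (Pᴷ ∘ HPolyᵣᴷ))(gᴷ) )`. [folklore] -/
theorem wordForm_eq_map {K : Type*} [Field K] (f : K →+* ℂ) (L : PeriodPair) (κM : δ → γ → Kbar)
    {g2 g3 : K} (hg2 : f g2 = L.g₂) (hg3 : f g3 = L.g₃) {κ : δ → γ → K}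
    (hκ : ∀ e b, f (κ e b) = κM e b) (c : γ → Bool) {d : ℕ} {xs : Fin d → β ⊕ (γ ⊕ δ) → ℂ}
    {xK : Fin d → β ⊕ (γ ⊕ δ) → K} (hx : ∀ m k, f (xK m k) = xs m k) {w : β ⊕ (γ ⊕ δ) → ℂ}
    {gK : Gen β γ δ → K} (hg : ∀ i, f (gK i) = genFun L κM c w 0 0 i)
    {P : MvPolynomial (Option β × ThetaIdx γ δ) ℂ} {PK : MvPolynomial (Option β × ThetaIdx γ δ) K}
    (hP : map f PK = P) {k : ℕ} (ω : Fin k → Fin d) :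
    wordForm L κM c xs w ω P =
      f (MvPolynomial.eval gK
        (PolyODE.wordApp (fun m => (mkDerivation K (genODEᵣ g2 g3 κ c (xK m))).toLinearMap) ω
          (MvPolynomial.bind₁ (HPolyᵣ g2 g3 κ c) PK))) := by
  -- the images of the `K`-data
  have hQ : ∀ m i, map f (genODEᵣ g2 g3 κ c (xK m) i) = genODE L κM c (xs m) i := by
    intro m i
    rw [map_genODEᵣ, hg2, hg3]
    have e1 : (fun e b => f (κ e b)) = fun e b => (κM e b : ℂ) := funext fun e => funext fun b => hκ e b
    have e2 : (fun k => f (xK m k)) = xs m := funext fun k => hx m k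
    rw [e1, e2, genODEᵣ_complex]
  have hH : (fun J : Option β × ThetaIdx γ δ => map f (HPolyᵣ g2 g3 κ c J)) = HPoly L κM c := by
    funext J
    rw [map_HPolyᵣ, hg2, hg3]
    have e1 : (fun e b => f (κ e b)) = fun e b => (κM e b : ℂ) := funext fun e => funext fun b => hκ e b
    rw [e1, ← HPolyᵣ_complex (β := β) L κM c]
  have hgf : (fun i => f (gK i)) = genFun L κM c w 0 0 := funext hg
  -- evaluate after mapping
  set Y := PolyODE.wordApp (fun m => (mkDerivation K (genODEᵣ g2 g3 κ c (xK m))).toLinearMap) ω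
    (MvPolynomial.bind₁ (HPolyᵣ g2 g3 κ c) PK) with hY
  have hev : f (MvPolynomial.eval gK Y) = MvPolynomial.eval (fun i => f (gK i)) (map f Y) := by
    rw [eval_map, show MvPolynomial.eval gK Y = eval₂ (RingHom.id K) gK Y from rfl, eval₂_comp_left,
      RingHom.comp_id]
    rfl
  rw [hev, hY, PolyODE.map_wordApp, map_bind₁, hP, hgf]
  simp only [hQ]
  rw [show (fun J : Option β × ThetaIdx γ δ => map f (HPolyᵣ g2 g3 κ c J)) = HPoly L κM c from hH]
  rfl

end Std

end GaGmE

end Literature.NumberTheory.Transcendental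

end
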